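import Summits.QuantumFields.BalabanUV.Beta.GAN24.DerivativeRateTransferJensen

/-!
# `BalabanUV.Beta.GAN24.DerivativeRateTransferRowDefect` — binder row G-an2-4 ∕ (CONV-C), route R6 «VALUES, NOT DERIVATIVES», PART 30:
# THE ROW DEFECT OF «PROLONGATE, THEN AVERAGE» IS FIRST-ORDER SMALL AGAINST THE ENERGY — for ANY map `M` on colour site fields whose value at a
# site is a CONVEX COMBINATION OF ORTHOGONALLY TRANSPORTED VALUES AT CHAIN-CONNECTED SITES, `Σ_z |(Mu − u)(z)|² ≤ A·ℓ·m·Σ_e|D_e u|² + B·g·|u|²`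
# (chain telescoping + Jensen + two counts), and after a transported block averaging `Q_c` with column count `g_c` the ROW DEFECT of PART 29 obeys
# `|Q_c(Mu − u)|² ≤ g_c·(…)`: flat loops ⟹ (ROW) against the fine ENERGY alone (no regularity, no decay); loops within κ ⟹ + κ²-mass
# (unit b2b-balaban-gan24-p3, gen 38; v1)

NOT IN PRINT; OUR PROOF (for the ROUTE; [folklore] finite sums + PART 21's chain letters and PART 22's counting pattern BY NAME).  HONEST FRAMING (cell contract,
verbatim): «discharging `BetaPertH` makes Bałaban's UV stability UNCONDITIONAL — a real constructive-QFT result; it is NOT the continuum limit and NOT the Clay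
problem.»  HONEST DEPENDENCY (verbatim): «continuum YM on T⁴ ⇐ BetaPertH ∧ nine spine estimates (0/9 proved); BetaPertH ⇐ (D1) ∧ (D4) ∧ CAP+tail; G-an2-4
gates asym, D1 and NE2/3/4.»

WHY THIS FILE.  PART 29 (`DerivativeRateTransferSqueeze`) replaced route R6's (CONS) by (PROL) + (ROW): the upper comparison of the effective forms needs, besides
the energy defect of the prolongation as a form inequality, only the `ℓ²`-size of the ROW DEFECT `r_y = Q_c^{(j+1)}P_jℋ_je_y − e_y = Q_c^{(j)}·(Qf_jP_j − 1)·ℋ_je_y`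
((1.17): `Q_c^{(j+1)} = Q_c^{(j)}Qf_j`, `Q_c^{(j)}ℋ_j = 1`).  The composite `M := Qf_j·P_j` («prolongate to the finer lattice, average back») of every
prolongation in use — multilinear (gan24-p2's `MultilinearProlongation.Pml`), its covariant version with transported corner values, King's smoothed injections —
has the shape `(Mu)(z) = Σ_k c(z,k)·O(z,k)·u(τ(z,k))`: nonnegative weights summing to ONE, orthogonal colour transporters, nearby sites `τ(z,k)` joined to `z`
by bond chains of length `≤ ℓ` (at `U = 1` for `Pml`: `k = T ⊆ {1..d}`, `c = a^{|T|}(1−a)^{d−|T|}`, `a = (L−1)∕(2L)`, `τ(z,T) = z + Σ_{ν∈T}e_ν`, `O = 1`).  For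
such `M` this file proves `Σ_z |(Mu − u)(z)|² ≤ A·ℓ·m·Σ_e|R_eu(e⁺) − u(e⁻)|² + B·g·|u|²` from a per-pair chain bound (PART 21: telescoping, chain Cauchy–Schwarz,
holonomy split), the c-weighted chain multiplicity `m` and the target count `g`; and `|Q_c w|² ≤ g_c·|w|²` for transported block averagings with column count
`g_c` (for unit blocks of `n^d` sites: `g_c = n^{−d}`).  With the fine form bracket `w_f·Σ_e|D_eu|² ≤ ⟨u,H_fu⟩`, `w_f = η^{d−2}`, `g_c = η^d`, this is (ROW) of PART 29:
`⟨r_y,r_y⟩ ≤ η²·(A·ℓ·m)·𝒮_j(y,y) + η^d·B·g·|ℋ_je_y|²` — FIRST ORDER IN `η_j = L^{−j}` AGAINST THE ENERGY, the curvature in the mass slot.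

WHAT THIS FILE PROVES (0 sorry, 0 `def`, nothing cited; real colour site fields `u : μ × o → ℝ`):
* §1 `sum_chain_le_of_multiplicity_var` (PART 22's chain count with chain lengths depending on the pair), `sum_tgt_le_of_count` (the target count).
* §2 `convex_sub_eq` (`(Mu − u)(z) = Σ_k c(z,k)·(O(z,k)u(τ(z,k)) − u(z))` when `Σ_k c(z,k) = 1`), **`sum_self_sub_le_core`** (the assembly from a per-pair bound).
* §3 `dotProduct_self_avg_le` (`|Q_c w|² ≤ g_c|w|²` — Jensen in each block, then the column count).
* §4 THE ENDS: **`rowDefect_flat`** (flat loops `O(z,k)·T_ℓ(z,k)ᵀ = 1`: `|Q_c(Mu − u)|² ≤ (g_c·ℓ·m∕w_f)·⟨u,H_fu⟩` under the bracket — no regularity, no decay,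
  no mass term), **`rowDefect_holonomy`** (loops within κ: `|Q_c(Mu − u)|² ≤ g_c·((1+t)·ℓ·(m·Σ_e|D_eu|²) + ((1+t⁻¹)κ²)·(g·|u|²))`, every `t > 0`).
WHAT IT DOES NOT DO: instantiate `c, O, τ`, the chains or `Q_c` on the block lattice (the `U = 1` multilinear instance: `m = a ≤ ½`, `ℓ = d`, `g ≤ 1`, `g_c = n^{−d}` —
companion PART 31, ON THE PRODUCT ENCODING OF PART 24); prove (PROL); bound κ; vector fields.  SUPPLIER work on route R6 (rank 2, REDUCTION, no seat); no consumer
of record; NEVER «G-an2-4 closed»; NOT (CONV-C), NOT D1, NOT `BetaPertH`, NOT continuum, NOT Clay.  Records: `HOME/b2b-balaban-gan24-p3/WOODBURY-FIBRE.md` v13.8.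
-/

noncomputable section

open Matrix Finset

namespace Summit.QuantumFields.BalabanUV.Beta.GAN24.DerivativeRateTransferRowDefect

open Summit.QuantumFields.BalabanUV.Beta.GAN24.DerivativeRateTransferJensenChain
open Summit.QuantumFields.BalabanUV.Beta.GAN24.DerivativeRateTransferJensen (dotProduct_self_eq_sum_sites)

/-! ## §1 Two counts -/

section Counting

variable {β μ K : Type*} [Fintype β] [DecidableEq β] [Fintype μ] [DecidableEq μ] [Fintype K]

omit [DecidableEq μ] in
/-- **THE CHAIN COUNT WITH PAIR-DEPENDENT LENGTHS**: if for every bond `e` the total weight of the chains through it is `≤ m`,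
`Σ_z Σ_k Σ_{i<ℓ(z,k)} [γ(z,k,i) = e]·c(z,k) ≤ m`, then `Σ_z Σ_k c(z,k)·Σ_{i<ℓ(z,k)} F(γ(z,k,i)) ≤ m·Σ_e F(e)` for every `F ≥ 0`. [folklore] -/
theorem sum_chain_le_of_multiplicity_var (cw : μ → K → ℝ) (γ : μ → K → ℕ → β) (ℓ : μ → K → ℕ) {m : ℝ}
    (hmult : ∀ e, ∑ z, ∑ k, ∑ i ∈ range (ℓ z k), (if γ z k i = e then cw z k else 0) ≤ m)
    (F : β → ℝ) (hF : ∀ e, 0 ≤ F e) :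
    ∑ z, ∑ k, cw z k * ∑ i ∈ range (ℓ z k), F (γ z k i) ≤ m * ∑ e, F e := by
  have h1 : ∀ z k, cw z k * ∑ i ∈ range (ℓ z k), F (γ z k i) =
      ∑ e, (∑ i ∈ range (ℓ z k), (if γ z k i = e then cw z k else 0)) * F e := by
    intro z k
    rw [Finset.mul_sum]
    simp_rw [Finset.sum_mul]
    rw [Finset.sum_comm]
    refine Finset.sum_congr rfl fun i _ => ?_
    simp_rw [ite_mul, zero_mul]
    rw [Finset.sum_ite_eq]
    simp
  have h2 : ∀ z, ∑ k, ∑ e, (∑ i ∈ range (ℓ z k), (if γ z k i = e then cw z k else 0)) * F e =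
      ∑ e, ∑ k, (∑ i ∈ range (ℓ z k), (if γ z k i = e then cw z k else 0)) * F e := fun z => Finset.sum_comm
  simp_rw [h1, h2]
  rw [Finset.sum_comm, Finset.mul_sum]
  refine Finset.sum_le_sum fun e _ => ?_
  simp_rw [← Finset.sum_mul]
  exact mul_le_mul_of_nonneg_right (hmult e) (hF e)

omit [Fintype β] [DecidableEq β] in
/-- **THE TARGET COUNT**: if every site is the target of total weight `≤ g`, `Σ_z Σ_k [τ(z,k) = x]·c(z,k) ≤ g`, then
`Σ_z Σ_k c(z,k)·M(τ(z,k)) ≤ g·Σ_x M(x)` for every `M ≥ 0`. [folklore] -/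
theorem sum_tgt_le_of_count (cw : μ → K → ℝ) (τ : μ → K → μ) {g : ℝ}
    (hcount : ∀ x, ∑ z, ∑ k, (if τ z k = x then cw z k else 0) ≤ g) (M : μ → ℝ) (hM : ∀ x, 0 ≤ M x) :
    ∑ z, ∑ k, cw z k * M (τ z k) ≤ g * ∑ x, M x := by
  have h1 : ∀ z k, cw z k * M (τ z k) = ∑ x, (if τ z k = x then cw z k else 0) * M x := fun z k => by
    simp_rw [ite_mul, zero_mul]
    rw [Finset.sum_ite_eq]
    simp
  have h2 : ∀ z, ∑ k, ∑ x, (if τ z k = x then cw z k else 0) * M x = ∑ x, ∑ k, (if τ z k = x then cw z k else 0) * M x :=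
    fun z => Finset.sum_comm
  simp_rw [h1, h2]
  rw [Finset.sum_comm, Finset.mul_sum]
  refine Finset.sum_le_sum fun x _ => ?_
  simp_rw [← Finset.sum_mul]
  exact mul_le_mul_of_nonneg_right (hcount x) (hM x)

end Counting

/-! ## §2 «Prolongate, then average»: a convex combination of transported values, minus the identity -/

section Convex

variable {o μ K β : Type*} [Fintype o] [Fintype μ] [DecidableEq μ] [Fintype K] [Fintype β] [DecidableEq β]
variable {cw : μ → K → ℝ} {O : μ → K → Matrix o o ℝ} {τ : μ → K → μ} {M : Matrix (μ × o) (μ × o) ℝ}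

omit [DecidableEq μ] [Fintype β] [DecidableEq β] in
/-- **`(Mu − u)(z) = Σ_k c(z,k)·(O(z,k)u(τ(z,k)) − u(z))`** when the weights sum to ONE. [folklore] -/
theorem convex_sub_eq (hc1 : ∀ z, ∑ k, cw z k = 1)
    (hM : ∀ (u : μ × o → ℝ) (z : μ), (fun a => (M *ᵥ u) (z, a)) = ∑ k, cw z k • (O z k *ᵥ fun b => u (τ z k, b)))
    (u : μ × o → ℝ) (z : μ) :
    (fun a => (M *ᵥ u) (z, a)) - (fun a => u (z, a)) = ∑ k, cw z k • ((O z k *ᵥ fun b => u (τ z k, b)) - fun b => u (z, b)) := by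
  rw [hM u z]
  simp_rw [smul_sub]
  rw [Finset.sum_sub_distrib, ← Finset.sum_smul, hc1 z, one_smul]

omit [DecidableEq μ] [Fintype β] [DecidableEq β] in
/-- `Σ_z |w(z)|²`-form of `|w|²` for a difference read sitewise. [folklore] -/
theorem dotProduct_self_sub_eq_sum_sites (w u : μ × o → ℝ) :
    (w - u) ⬝ᵥ (w - u) = ∑ z, ((fun a => w (z, a)) - fun a => u (z, a)) ⬝ᵥ ((fun a => w (z, a)) - fun a => u (z, a)) := by
  rw [dotProduct_self_eq_sum_sites]
  rfl

/-- **`sum_self_sub_le_core` — THE ASSEMBLY** [our proof]: weights `c ≥ 0` with `Σ_k c(z,k) = 1`, the structure `hM`, a PER-PAIR bound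
`|O(z,k)u(τ(z,k)) − u(z)|² ≤ A·(ℓ·Σ_{i<ℓ(z,k)} F(γ(z,k,i))) + B·|u(τ(z,k))|²` with `F(e) = |R_eu(e⁺) − u(e⁻)|²` (`A, B ≥ 0`), the chain count `m` and
the target count `g` ⟹ `|Mu − u|² ≤ A·ℓ·m·Σ_e F(e) + B·g·|u|²`. -/
theorem sum_self_sub_le_core (hc0 : ∀ z k, 0 ≤ cw z k) (hc1 : ∀ z, ∑ k, cw z k = 1)
    (hM : ∀ (u : μ × o → ℝ) (z : μ), (fun a => (M *ᵥ u) (z, a)) = ∑ k, cw z k • (O z k *ᵥ fun b => u (τ z k, b)))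
    {src tgt : β → μ} {R : β → Matrix o o ℝ} {ℓmax : ℕ} {ℓ : μ → K → ℕ} {γ : μ → K → ℕ → β} {m g : ℝ}
    (hmult : ∀ e, ∑ z, ∑ k, ∑ i ∈ range (ℓ z k), (if γ z k i = e then cw z k else 0) ≤ m)
    (hcount : ∀ x, ∑ z, ∑ k, (if τ z k = x then cw z k else 0) ≤ g)
    {A Bk : ℝ} (hA : 0 ≤ A) (hBk : 0 ≤ Bk) (u : μ × o → ℝ)
    (hpair : ∀ z k,
      ((O z k *ᵥ fun b => u (τ z k, b)) - fun b => u (z, b)) ⬝ᵥ ((O z k *ᵥ fun b => u (τ z k, b)) - fun b => u (z, b)) ≤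
        A * (ℓmax * ∑ i ∈ range (ℓ z k),
              ((R (γ z k i) *ᵥ fun b => u (tgt (γ z k i), b)) - fun b => u (src (γ z k i), b)) ⬝ᵥ
                ((R (γ z k i) *ᵥ fun b => u (tgt (γ z k i), b)) - fun b => u (src (γ z k i), b))) +
          Bk * ((fun b => u (τ z k, b)) ⬝ᵥ fun b => u (τ z k, b))) :
    (M *ᵥ u - u) ⬝ᵥ (M *ᵥ u - u) ≤
      A * ℓmax * (m * ∑ e, ((R e *ᵥ fun b => u (tgt e, b)) - fun b => u (src e, b)) ⬝ᵥ
                ((R e *ᵥ fun b => u (tgt e, b)) - fun b => u (src e, b))) +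
        Bk * (g * (u ⬝ᵥ u)) := by
  set F : β → ℝ := fun e => ((R e *ᵥ fun b => u (tgt e, b)) - fun b => u (src e, b)) ⬝ᵥ
    ((R e *ᵥ fun b => u (tgt e, b)) - fun b => u (src e, b)) with hF
  set Mf : μ → ℝ := fun x => (fun b => u (x, b)) ⬝ᵥ fun b => u (x, b) with hMf
  have hF0 : ∀ e, 0 ≤ F e := fun e => dotProduct_self_nonneg' _
  have hM0 : ∀ x, 0 ≤ Mf x := fun x => dotProduct_self_nonneg' _
  have hpair' : ∀ z k, ((O z k *ᵥ fun b => u (τ z k, b)) - fun b => u (z, b)) ⬝ᵥ ((O z k *ᵥ fun b => u (τ z k, b)) - fun b => u (z, b)) ≤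
      A * (ℓmax * ∑ i ∈ range (ℓ z k), F (γ z k i)) + Bk * Mf (τ z k) := fun z k => hpair z k
  -- per site: Jensen over `k`, then the per-pair bound
  have hsite : ∀ z, ((fun a => (M *ᵥ u) (z, a)) - fun a => u (z, a)) ⬝ᵥ ((fun a => (M *ᵥ u) (z, a)) - fun a => u (z, a)) ≤
      A * ℓmax * ∑ k, cw z k * ∑ i ∈ range (ℓ z k), F (γ z k i) + Bk * ∑ k, cw z k * Mf (τ z k) := by
    intro z
    rw [convex_sub_eq hc1 hM u z]
    refine (dotProduct_self_wsum_le' Finset.univ (fun k _ => hc0 z k) (le_of_eq (hc1 z)) _).trans ?_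
    calc ∑ k, cw z k * (((O z k *ᵥ fun b => u (τ z k, b)) - fun b => u (z, b)) ⬝ᵥ ((O z k *ᵥ fun b => u (τ z k, b)) - fun b => u (z, b)))
        ≤ ∑ k, cw z k * (A * (ℓmax * ∑ i ∈ range (ℓ z k), F (γ z k i)) + Bk * Mf (τ z k)) :=
          Finset.sum_le_sum fun k _ => mul_le_mul_of_nonneg_left (hpair' z k) (hc0 z k)
      _ = A * ℓmax * ∑ k, cw z k * ∑ i ∈ range (ℓ z k), F (γ z k i) + Bk * ∑ k, cw z k * Mf (τ z k) := by
          rw [Finset.mul_sum, Finset.mul_sum, ← Finset.sum_add_distrib]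
          exact Finset.sum_congr rfl fun k _ => by ring
  -- sum over the sites
  have hsum : ∑ z, ((fun a => (M *ᵥ u) (z, a)) - fun a => u (z, a)) ⬝ᵥ ((fun a => (M *ᵥ u) (z, a)) - fun a => u (z, a)) ≤
      A * ℓmax * ∑ z, ∑ k, cw z k * ∑ i ∈ range (ℓ z k), F (γ z k i) + Bk * ∑ z, ∑ k, cw z k * Mf (τ z k) := by
    refine (Finset.sum_le_sum fun z _ => hsite z).trans (le_of_eq ?_)
    rw [Finset.sum_add_distrib, ← Finset.mul_sum, ← Finset.mul_sum]
  have hmu := sum_chain_le_of_multiplicity_var cw γ ℓ hmult F hF0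
  have hgr := sum_tgt_le_of_count cw τ hcount Mf hM0
  have hMu : ∑ x, Mf x = u ⬝ᵥ u := (dotProduct_self_eq_sum_sites u).symm
  rw [dotProduct_self_sub_eq_sum_sites]
  refine hsum.trans ?_
  rw [← hMu]
  exact add_le_add (mul_le_mul_of_nonneg_left hmu (mul_nonneg hA (Nat.cast_nonneg _))) (mul_le_mul_of_nonneg_left hgr hBk)

end Convex

/-! ## §3 The transported block averaging to the unit level: Jensen per block, then the column count -/

section Average

variable {o c μ : Type*} [Fintype o] [DecidableEq o] [Fintype c] [Fintype μ]
variable {qc : c → μ → ℝ} {Wc : c → μ → Matrix o o ℝ} {Qc : Matrix (c × o) (μ × o) ℝ}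

/-- **`dotProduct_self_avg_le` — `|Q_c w|² ≤ g_c·|w|²`** [our proof]: block weights `q_c ≥ 0` with `Σ_z q_c(y,z) ≤ 1`, orthogonal block transporters, the
structure `(Q_c w)(y) = Σ_z q_c(y,z)·W_c(y,z)w(z)` and the COLUMN count `Σ_y q_c(y,z) ≤ g_c` (unit blocks of `n^d` sites: `g_c = n^{−d}`). -/
theorem dotProduct_self_avg_le (hq0 : ∀ y z, 0 ≤ qc y z) (hq1 : ∀ y, ∑ z, qc y z ≤ 1) (hW : ∀ y z, (Wc y z)ᵀ * Wc y z = 1)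
    (hQc : ∀ (w : μ × o → ℝ) (y : c), (fun a => (Qc *ᵥ w) (y, a)) = ∑ z, qc y z • (Wc y z *ᵥ fun b => w (z, b)))
    {gc : ℝ} (hcol : ∀ z, ∑ y, qc y z ≤ gc) (w : μ × o → ℝ) :
    (Qc *ᵥ w) ⬝ᵥ (Qc *ᵥ w) ≤ gc * (w ⬝ᵥ w) := by
  set Mf : μ → ℝ := fun z => (fun b => w (z, b)) ⬝ᵥ fun b => w (z, b) with hMf
  have hM0 : ∀ z, 0 ≤ Mf z := fun z => dotProduct_self_nonneg' _
  rw [dotProduct_self_eq_sum_sites (Qc *ᵥ w), dotProduct_self_eq_sum_sites w]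
  have hy : ∀ y, (fun a => (Qc *ᵥ w) (y, a)) ⬝ᵥ (fun a => (Qc *ᵥ w) (y, a)) ≤ ∑ z, qc y z * Mf z := fun y => by
    rw [hQc w y]
    exact dotProduct_self_wsum_le Finset.univ (fun z _ => hq0 y z) (hq1 y) (fun z _ => hW y z) _
  refine (Finset.sum_le_sum fun y _ => hy y).trans ?_
  rw [Finset.sum_comm, Finset.mul_sum]
  refine Finset.sum_le_sum fun z _ => ?_
  rw [← Finset.sum_mul]
  exact mul_le_mul_of_nonneg_right (hcol z) (hM0 z)

end Average

/-! ## §4 THE ENDS: (ROW) for flat loops against the energy alone; (ROW) with loops within κ -/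

section Ends

variable {o c μ K β : Type*} [Fintype o] [DecidableEq o] [Fintype c] [Fintype μ] [DecidableEq μ] [Fintype K] [Fintype β] [DecidableEq β]
variable {cw : μ → K → ℝ} {O : μ → K → Matrix o o ℝ} {τ : μ → K → μ} {M : Matrix (μ × o) (μ × o) ℝ}
variable {qc : c → μ → ℝ} {Wc : c → μ → Matrix o o ℝ} {Qc : Matrix (c × o) (μ × o) ℝ}
variable {src tgt : β → μ} {R : β → Matrix o o ℝ} {ℓmax : ℕ} {ℓ : μ → K → ℕ} {xs : μ → K → ℕ → μ} {γ : μ → K → ℕ → β}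
variable {T : μ → K → ℕ → Matrix o o ℝ} {m g gc : ℝ}

omit [Fintype c] [Fintype μ] [DecidableEq μ] [Fintype K] [Fintype β] [DecidableEq β] in
/-- the per-pair chain bound, flat: `O(z,k)·T_ℓ(z,k)ᵀ = 1` ⟹ `|O(z,k)u(τ(z,k)) − u(z)|² ≤ 1·(ℓ·Σ_{i<ℓ(z,k)}|D_{γ(z,k,i)}u|²) + 0·|u(τ(z,k))|²`. [our proof] -/
theorem pair_flat (hR : ∀ e, (R e)ᵀ * R e = 1) (hx0 : ∀ z k, xs z k 0 = z) (hxℓ : ∀ z k, xs z k (ℓ z k) = τ z k)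
    (hsrc : ∀ z k i, i < ℓ z k → src (γ z k i) = xs z k i) (htgt : ∀ z k i, i < ℓ z k → tgt (γ z k i) = xs z k (i + 1))
    (hT0 : ∀ z k, T z k 0 = 1) (hT : ∀ z k i, i < ℓ z k → T z k (i + 1) = T z k i * R (γ z k i)) (hℓ : ∀ z k, ℓ z k ≤ ℓmax)
    (hflat : ∀ z k, O z k * (T z k (ℓ z k))ᵀ = 1) (u : μ × o → ℝ) (z : μ) (k : K) :
    ((O z k *ᵥ fun b => u (τ z k, b)) - fun b => u (z, b)) ⬝ᵥ ((O z k *ᵥ fun b => u (τ z k, b)) - fun b => u (z, b)) ≤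
      1 * (ℓmax * ∑ i ∈ range (ℓ z k),
            ((R (γ z k i) *ᵥ fun b => u (tgt (γ z k i), b)) - fun b => u (src (γ z k i), b)) ⬝ᵥ
              ((R (γ z k i) *ᵥ fun b => u (tgt (γ z k i), b)) - fun b => u (src (γ z k i), b))) +
        0 * ((fun b => u (τ z k, b)) ⬝ᵥ fun b => u (τ z k, b)) := by
  have hTl : (T z k (ℓ z k))ᵀ * T z k (ℓ z k) = 1 :=
    orthogonal_partialTransport (R := fun i => R (γ z k i)) (fun i _ => hR _) (hT0 z k) (fun i hi => hT z k i hi) (ℓ z k) le_rfl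
  have hO : O z k = T z k (ℓ z k) := by
    have e := congrArg (· * T z k (ℓ z k)) (hflat z k)
    simpa only [Matrix.mul_assoc, hTl, Matrix.mul_one, Matrix.one_mul] using e
  have h := dotProduct_self_chain_le (R := fun i => R (γ z k i)) (T := T z k) (fun i _ => hR _) (hT0 z k)
    (fun i hi => hT z k i hi) (fun i => fun b => u (xs z k i, b))
  rw [hxℓ, hx0] at h
  have hs : ∑ i ∈ range (ℓ z k), ((R (γ z k i) *ᵥ fun b => u (tgt (γ z k i), b)) - fun b => u (src (γ z k i), b)) ⬝ᵥ
        ((R (γ z k i) *ᵥ fun b => u (tgt (γ z k i), b)) - fun b => u (src (γ z k i), b)) =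
      ∑ i ∈ range (ℓ z k), ((R (γ z k i) *ᵥ fun b => u (xs z k (i + 1), b)) - fun b => u (xs z k i, b)) ⬝ᵥ
        ((R (γ z k i) *ᵥ fun b => u (xs z k (i + 1), b)) - fun b => u (xs z k i, b)) :=
    Finset.sum_congr rfl fun i hi => by rw [hsrc z k i (mem_range.mp hi), htgt z k i (mem_range.mp hi)]
  have hS0 : 0 ≤ ∑ i ∈ range (ℓ z k), ((R (γ z k i) *ᵥ fun b => u (xs z k (i + 1), b)) - fun b => u (xs z k i, b)) ⬝ᵥ
      ((R (γ z k i) *ᵥ fun b => u (xs z k (i + 1), b)) - fun b => u (xs z k i, b)) := Finset.sum_nonneg fun i _ => dotProduct_self_nonneg' _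
  rw [hO, hs, one_mul, zero_mul, add_zero]
  refine h.trans ?_
  exact mul_le_mul_of_nonneg_right (Nat.cast_le.mpr (hℓ z k)) hS0

omit [Fintype c] [Fintype μ] [DecidableEq μ] [Fintype K] [Fintype β] [DecidableEq β] in
/-- the per-pair chain bound with a loop within κ: `|(O(z,k)T_ℓᵀ − 1)w|² ≤ κ²|w|²` ⟹
`|O(z,k)u(τ(z,k)) − u(z)|² ≤ (1+t)·(ℓ·Σ_{i<ℓ(z,k)}|D_{γ(z,k,i)}u|²) + ((1+t⁻¹)κ²)·|u(τ(z,k))|²` for every `t > 0`. [our proof] -/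
theorem pair_holonomy (hR : ∀ e, (R e)ᵀ * R e = 1) (hx0 : ∀ z k, xs z k 0 = z) (hxℓ : ∀ z k, xs z k (ℓ z k) = τ z k)
    (hsrc : ∀ z k i, i < ℓ z k → src (γ z k i) = xs z k i) (htgt : ∀ z k i, i < ℓ z k → tgt (γ z k i) = xs z k (i + 1))
    (hT0 : ∀ z k, T z k 0 = 1) (hT : ∀ z k i, i < ℓ z k → T z k (i + 1) = T z k i * R (γ z k i)) (hℓ : ∀ z k, ℓ z k ≤ ℓmax)
    {κ : ℝ} (hV : ∀ z k (w : o → ℝ),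
      ((O z k * (T z k (ℓ z k))ᵀ - 1) *ᵥ w) ⬝ᵥ ((O z k * (T z k (ℓ z k))ᵀ - 1) *ᵥ w) ≤ κ ^ 2 * (w ⬝ᵥ w))
    {t : ℝ} (ht : 0 < t) (u : μ × o → ℝ) (z : μ) (k : K) :
    ((O z k *ᵥ fun b => u (τ z k, b)) - fun b => u (z, b)) ⬝ᵥ ((O z k *ᵥ fun b => u (τ z k, b)) - fun b => u (z, b)) ≤
      (1 + t) * (ℓmax * ∑ i ∈ range (ℓ z k),
            ((R (γ z k i) *ᵥ fun b => u (tgt (γ z k i), b)) - fun b => u (src (γ z k i), b)) ⬝ᵥ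
              ((R (γ z k i) *ᵥ fun b => u (tgt (γ z k i), b)) - fun b => u (src (γ z k i), b))) +
        ((1 + t⁻¹) * κ ^ 2) * ((fun b => u (τ z k, b)) ⬝ᵥ fun b => u (τ z k, b)) := by
  have hTl : (T z k (ℓ z k))ᵀ * T z k (ℓ z k) = 1 :=
    orthogonal_partialTransport (R := fun i => R (γ z k i)) (fun i _ => hR _) (hT0 z k) (fun i hi => hT z k i hi) (ℓ z k) le_rfl
  have hO : (O z k *ᵥ fun b => u (τ z k, b)) = (O z k * (T z k (ℓ z k))ᵀ) *ᵥ (T z k (ℓ z k) *ᵥ fun b => u (τ z k, b)) := by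
    rw [mulVec_mulVec, Matrix.mul_assoc, hTl, Matrix.mul_one]
  have h := dotProduct_self_holonomy_chain_le (R := fun i => R (γ z k i)) (T := T z k) (fun i _ => hR _) (hT0 z k)
    (fun i hi => hT z k i hi) (hV z k) ht (fun i => fun b => u (xs z k i, b))
  rw [hxℓ, hx0] at h
  have hs : ∑ i ∈ range (ℓ z k), ((R (γ z k i) *ᵥ fun b => u (tgt (γ z k i), b)) - fun b => u (src (γ z k i), b)) ⬝ᵥ
        ((R (γ z k i) *ᵥ fun b => u (tgt (γ z k i), b)) - fun b => u (src (γ z k i), b)) =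
      ∑ i ∈ range (ℓ z k), ((R (γ z k i) *ᵥ fun b => u (xs z k (i + 1), b)) - fun b => u (xs z k i, b)) ⬝ᵥ
        ((R (γ z k i) *ᵥ fun b => u (xs z k (i + 1), b)) - fun b => u (xs z k i, b)) :=
    Finset.sum_congr rfl fun i hi => by rw [hsrc z k i (mem_range.mp hi), htgt z k i (mem_range.mp hi)]
  have hS0 : 0 ≤ ∑ i ∈ range (ℓ z k), ((R (γ z k i) *ᵥ fun b => u (xs z k (i + 1), b)) - fun b => u (xs z k i, b)) ⬝ᵥ
      ((R (γ z k i) *ᵥ fun b => u (xs z k (i + 1), b)) - fun b => u (xs z k i, b)) := Finset.sum_nonneg fun i _ => dotProduct_self_nonneg' _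
  rw [hO, hs]
  refine h.trans ?_
  have h1 : (ℓ z k : ℝ) * ∑ i ∈ range (ℓ z k), ((R (γ z k i) *ᵥ fun b => u (xs z k (i + 1), b)) - fun b => u (xs z k i, b)) ⬝ᵥ
        ((R (γ z k i) *ᵥ fun b => u (xs z k (i + 1), b)) - fun b => u (xs z k i, b)) ≤
      (ℓmax : ℝ) * ∑ i ∈ range (ℓ z k), ((R (γ z k i) *ᵥ fun b => u (xs z k (i + 1), b)) - fun b => u (xs z k i, b)) ⬝ᵥ
        ((R (γ z k i) *ᵥ fun b => u (xs z k (i + 1), b)) - fun b => u (xs z k i, b)) :=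
    mul_le_mul_of_nonneg_right (Nat.cast_le.mpr (hℓ z k)) hS0
  have h2 := mul_le_mul_of_nonneg_left h1 (by linarith : (0 : ℝ) ≤ 1 + t)
  linarith [h2]

/-- **`rowDefect_flat` — (ROW) AGAINST THE FINE ENERGY ALONE, FLAT LOOPS** [our proof]: the structure of §2–§3 (weights `c ≥ 0`, `Σ_k c = 1`, orthogonal `O`;
block weights `q_c ≥ 0`, `Σ_z q_c ≤ 1`, orthogonal `W_c`, column count `g_c`), forward bond chains `xs, γ, T` of lengths `ℓ(z,k) ≤ ℓ` from `z` to `τ(z,k)`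
with orthogonal bond transporters, chain count `m`, FLAT loops `O(z,k)·T_ℓ(z,k)ᵀ = 1`, and the fine form bracket `w_f·Σ_e|D_eu|² ≤ ⟨u,H_fu⟩` (`0 < w_f`)
⟹ `|Q_c(Mu − u)|² ≤ (g_c·ℓ·m∕w_f)·⟨u, H_f u⟩` — no regularity of `u`, no decay, no mass term. -/
theorem rowDefect_flat (hc0 : ∀ z k, 0 ≤ cw z k) (hc1 : ∀ z, ∑ k, cw z k = 1)
    (hM : ∀ (u : μ × o → ℝ) (z : μ), (fun a => (M *ᵥ u) (z, a)) = ∑ k, cw z k • (O z k *ᵥ fun b => u (τ z k, b)))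
    (hq0 : ∀ y z, 0 ≤ qc y z) (hq1 : ∀ y, ∑ z, qc y z ≤ 1) (hW : ∀ y z, (Wc y z)ᵀ * Wc y z = 1)
    (hQc : ∀ (w : μ × o → ℝ) (y : c), (fun a => (Qc *ᵥ w) (y, a)) = ∑ z, qc y z • (Wc y z *ᵥ fun b => w (z, b)))
    (hcol : ∀ z, ∑ y, qc y z ≤ gc) (hgc : 0 ≤ gc) (hR : ∀ e, (R e)ᵀ * R e = 1)
    (hx0 : ∀ z k, xs z k 0 = z) (hxℓ : ∀ z k, xs z k (ℓ z k) = τ z k)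
    (hsrc : ∀ z k i, i < ℓ z k → src (γ z k i) = xs z k i) (htgt : ∀ z k i, i < ℓ z k → tgt (γ z k i) = xs z k (i + 1))
    (hT0 : ∀ z k, T z k 0 = 1) (hT : ∀ z k i, i < ℓ z k → T z k (i + 1) = T z k i * R (γ z k i)) (hℓ : ∀ z k, ℓ z k ≤ ℓmax)
    (hmult : ∀ e, ∑ z, ∑ k, ∑ i ∈ range (ℓ z k), (if γ z k i = e then cw z k else 0) ≤ m) (hm : 0 ≤ m)
    (hflat : ∀ z k, O z k * (T z k (ℓ z k))ᵀ = 1)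
    {Hf : Matrix (μ × o) (μ × o) ℝ} {wf : ℝ} (hwf : 0 < wf)
    (hHf : ∀ u : μ × o → ℝ, wf * ∑ e, ((R e *ᵥ fun b => u (tgt e, b)) - fun b => u (src e, b)) ⬝ᵥ
        ((R e *ᵥ fun b => u (tgt e, b)) - fun b => u (src e, b)) ≤ u ⬝ᵥ (Hf *ᵥ u))
    (u : μ × o → ℝ) :
    (Qc *ᵥ (M *ᵥ u - u)) ⬝ᵥ (Qc *ᵥ (M *ᵥ u - u)) ≤ gc * ℓmax * m / wf * (u ⬝ᵥ (Hf *ᵥ u)) := by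
  have hcount : ∀ x, ∑ z, ∑ k, (if τ z k = x then cw z k else 0) ≤ ∑ x', ∑ z, ∑ k, (if τ z k = x' then cw z k else 0) := fun x =>
    Finset.single_le_sum (f := fun x' => ∑ z, ∑ k, (if τ z k = x' then cw z k else 0))
      (fun x' _ => Finset.sum_nonneg fun z _ => Finset.sum_nonneg fun k _ => by
        split_ifs
        · exact hc0 z k
        · exact le_rfl)
      (Finset.mem_univ x)
  have hcore := sum_self_sub_le_core hc0 hc1 hM hmult hcount zero_le_one le_rfl u
    (pair_flat hR hx0 hxℓ hsrc htgt hT0 hT hℓ hflat u)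
  have havg := dotProduct_self_avg_le hq0 hq1 hW hQc hcol (M *ᵥ u - u)
  refine havg.trans ?_
  have h1 : (M *ᵥ u - u) ⬝ᵥ (M *ᵥ u - u) ≤ ℓmax * m * ∑ e, ((R e *ᵥ fun b => u (tgt e, b)) - fun b => u (src e, b)) ⬝ᵥ
      ((R e *ᵥ fun b => u (tgt e, b)) - fun b => u (src e, b)) := by
    refine hcore.trans (le_of_eq ?_); ring
  have h2 : ∑ e, ((R e *ᵥ fun b => u (tgt e, b)) - fun b => u (src e, b)) ⬝ᵥ ((R e *ᵥ fun b => u (tgt e, b)) - fun b => u (src e, b)) ≤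
      (u ⬝ᵥ (Hf *ᵥ u)) / wf := by
    rw [le_div_iff₀ hwf, mul_comm]; exact hHf u
  have h3 : (ℓmax : ℝ) * m * ∑ e, ((R e *ᵥ fun b => u (tgt e, b)) - fun b => u (src e, b)) ⬝ᵥ
        ((R e *ᵥ fun b => u (tgt e, b)) - fun b => u (src e, b)) ≤ ℓmax * m * ((u ⬝ᵥ (Hf *ᵥ u)) / wf) :=
    mul_le_mul_of_nonneg_left h2 (mul_nonneg (Nat.cast_nonneg _) hm)
  calc gc * ((M *ᵥ u - u) ⬝ᵥ (M *ᵥ u - u)) ≤ gc * (ℓmax * m * ((u ⬝ᵥ (Hf *ᵥ u)) / wf)) :=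
        mul_le_mul_of_nonneg_left (h1.trans h3) hgc
    _ = gc * ℓmax * m / wf * (u ⬝ᵥ (Hf *ᵥ u)) := by
        field_simp

/-- **`rowDefect_holonomy` — (ROW) WITH LOOPS WITHIN κ** [our proof]: the same structure with the loop holonomies `O(z,k)·T_ℓ(z,k)ᵀ` within `κ` of `1` and the
target count `g` ⟹ for every `t > 0`:
`|Q_c(Mu − u)|² ≤ g_c·((1+t)·ℓ·(m·Σ_e|D_eu|²) + ((1+t⁻¹)κ²)·(g·|u|²))` — energy at first order, curvature in the mass slot. -/
theorem rowDefect_holonomy (hc0 : ∀ z k, 0 ≤ cw z k) (hc1 : ∀ z, ∑ k, cw z k = 1)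
    (hM : ∀ (u : μ × o → ℝ) (z : μ), (fun a => (M *ᵥ u) (z, a)) = ∑ k, cw z k • (O z k *ᵥ fun b => u (τ z k, b)))
    (hq0 : ∀ y z, 0 ≤ qc y z) (hq1 : ∀ y, ∑ z, qc y z ≤ 1) (hW : ∀ y z, (Wc y z)ᵀ * Wc y z = 1)
    (hQc : ∀ (w : μ × o → ℝ) (y : c), (fun a => (Qc *ᵥ w) (y, a)) = ∑ z, qc y z • (Wc y z *ᵥ fun b => w (z, b)))
    (hcol : ∀ z, ∑ y, qc y z ≤ gc) (hgc : 0 ≤ gc) (hR : ∀ e, (R e)ᵀ * R e = 1)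
    (hx0 : ∀ z k, xs z k 0 = z) (hxℓ : ∀ z k, xs z k (ℓ z k) = τ z k)
    (hsrc : ∀ z k i, i < ℓ z k → src (γ z k i) = xs z k i) (htgt : ∀ z k i, i < ℓ z k → tgt (γ z k i) = xs z k (i + 1))
    (hT0 : ∀ z k, T z k 0 = 1) (hT : ∀ z k i, i < ℓ z k → T z k (i + 1) = T z k i * R (γ z k i)) (hℓ : ∀ z k, ℓ z k ≤ ℓmax)
    (hmult : ∀ e, ∑ z, ∑ k, ∑ i ∈ range (ℓ z k), (if γ z k i = e then cw z k else 0) ≤ m)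
    (hcount : ∀ x, ∑ z, ∑ k, (if τ z k = x then cw z k else 0) ≤ g)
    {κ : ℝ} (hV : ∀ z k (w : o → ℝ),
      ((O z k * (T z k (ℓ z k))ᵀ - 1) *ᵥ w) ⬝ᵥ ((O z k * (T z k (ℓ z k))ᵀ - 1) *ᵥ w) ≤ κ ^ 2 * (w ⬝ᵥ w))
    {t : ℝ} (ht : 0 < t) (u : μ × o → ℝ) :
    (Qc *ᵥ (M *ᵥ u - u)) ⬝ᵥ (Qc *ᵥ (M *ᵥ u - u)) ≤
      gc * ((1 + t) * ℓmax * (m * ∑ e, ((R e *ᵥ fun b => u (tgt e, b)) - fun b => u (src e, b)) ⬝ᵥ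
                ((R e *ᵥ fun b => u (tgt e, b)) - fun b => u (src e, b))) +
        ((1 + t⁻¹) * κ ^ 2) * (g * (u ⬝ᵥ u))) := by
  have hA : (0 : ℝ) ≤ 1 + t := by linarith
  have hBk : (0 : ℝ) ≤ (1 + t⁻¹) * κ ^ 2 := by positivity
  have hcore := sum_self_sub_le_core hc0 hc1 hM hmult hcount hA hBk u
    (pair_holonomy hR hx0 hxℓ hsrc htgt hT0 hT hℓ hV ht u)
  exact (dotProduct_self_avg_le hq0 hq1 hW hQc hcol (M *ᵥ u - u)).trans (mul_le_mul_of_nonneg_left hcore hgc)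

end Ends

end Summit.QuantumFields.BalabanUV.Beta.GAN24.DerivativeRateTransferRowDefect

end
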